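import Mathlib
import Summits.ValiantsHypothesis.ValiantsHypothesis.Theorems.RigidityForcesSymmetryRankRigidMinimalReprLaplaceContractRect
import Summits.ValiantsHypothesis.ValiantsHypothesis.Theorems.RigidityForcesSymmetryRankRigidMinimalReprLaplaceFourFiveDefs

/-!
# Rectangular contraction at `d + 1 = 5`: the slice-degree count from LO(4,5)
# (crux `RankRigidMinimalRepr`, stmt-ValiantsHypothesis-18034; frontier rung `LaplaceOptimalFive`, stmt-24813)

The normal-form corollary of `LaplaceContractRect.contract_rect` (`…LaplaceContractRect.lean`) one letter up from p8 g11's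
`contract_five`: ASSUME LO(4,5) in weight form — every split-rank-one decomposition of the `4`-slot, `5`-letter injective
pattern has `10 ≤ Σ_t wt |S_t|` with `wt 2 = 1` (pairs), `wt 1 = wt 3 = 2` (slices), `wt 0 = wt 4 = 10` — entering as the
hypothesis `h45 : LaplaceOptimalFourFive` (`…LaplaceFourFiveDefs.lean`; OPEN, nothing about it is asserted here).  Then for
slices `α_k(v_{i k}) · W_k(v)` and pair terms
`u_t(v_{p t}, v_{q t}) · w_t(v)` summing to the `5 × 5` permutation pattern, and a slot `s` whose slice vectors are
orthogonal to a covector with ALL coordinates non-zero (always available when no slice sits at `s`; letter-indicator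
slices are the exception):

* `contract_five_rect` — `10 ≤ 2·#{k : i k ≠ s} + 2·#{t : s ∈ {p t, q t}} + #{t : s ∉ {p t, q t}}`;
* `config_contract_rect` — contrapositive packaging;
* `no_idle_slot_of_fourFive` — the pair half of LO(4,5) follows from `LaplaceOptimalFourFive`, hence (`no_idle_slot_of_rect`)
  a slice-free cheap decomposition of `P₅` has every slot on the `2`-side of some term.

For the maximal cheap profiles of `P₅` (`2a + b = 9`) the count fails at a slot `s` iff `d_s ≤ 2a_s` (`a_s` slices and
`d_s` pair-ends at `s`): given LO(4,5) this disposes of 342/350 profiles with `a = 2` and 375/606 with `a = 1` (this seat's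
enumeration, memo on the item), up to the indicator exception.  No definitions.  HONEST FRAMING: a conditional transfer;
LO(4,5) is NOT proved here; `LaplaceOptimalFive` (stmt-24813) stays OPEN; nothing here bears on `VP ≠ VNP`.
-/

set_option autoImplicit false

-- the mandated summit-side namespace repeats a component by design (single-problem summit)
set_option linter.dupNamespace false

namespace Summit.ValiantsHypothesis.ValiantsHypothesis.Theorems.RigidityForcesSymmetryRankRigidMinimalRepr

namespace LaplaceContractRect

open Finset

/-! ### §4 `d + 1 = 5`: the slice-degree count from LO(4,5) -/

/-- **Rectangular contraction count at `d + 1 = 5`.**  Assume LO(4,5) in weight form (`wt 2 = 1`, `wt 1 = wt 3 = 2`,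
`wt 0 = wt 4 = 10`, bound `10`).  Slices `α_k(v_{i k}) · W_k(v)` and pair terms `u_t(v_{p t}, v_{q t}) · w_t(v)` summing to
the `5 × 5` permutation pattern; a slot `s` and a covector `lam` with ALL coordinates non-zero orthogonal to the slice
vectors at `s`.  Then `10 ≤ 2·#{k : i k ≠ s} + 2·#{t : s ∈ {p t, q t}} + #{t : s ∉ {p t, q t}}`.  (Such a `lam` exists iff
the span of the slice vectors at `s` has dimension `< 5` and contains no basis vector — e.g. always when no slice sits at
`s`; letter-indicator slices are the exception.) -/
theorem contract_five_rect
    (h45 : LaplaceOptimalFourFive)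
    {Ns Np : ℕ}
    (i : Fin Ns → Fin 5) (α : Fin Ns → Fin 5 → ℂ) (W : Fin Ns → (Fin 5 → Fin 5) → ℂ)
    (hW : ∀ k, ∀ v v' : Fin 5 → Fin 5, (∀ j, j ≠ i k → v j = v' j) → W k v = W k v')
    (p q : Fin Np → Fin 5) (hpq : ∀ t, p t ≠ q t) (u w : Fin Np → (Fin 5 → Fin 5) → ℂ)
    (hu : ∀ t, ∀ v v' : Fin 5 → Fin 5, v (p t) = v' (p t) → v (q t) = v' (q t) → u t v = u t v')
    (hw : ∀ t, ∀ v v' : Fin 5 → Fin 5, (∀ j, j ≠ p t → j ≠ q t → v j = v' j) → w t v = w t v')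
    (H : ∀ v : Fin 5 → Fin 5,
      (if Function.Injective v then (1 : ℂ) else 0) = (∑ k, α k (v (i k)) * W k v) + ∑ t, u t v * w t v)
    (s : Fin 5) (lam : Fin 5 → ℂ) (hlam : ∀ c, lam c ≠ 0) (hkill : ∀ k, i k = s → ∑ c, lam c * α k c = 0) :
    10 ≤ 2 * (univ.filter (fun k => i k ≠ s)).card + 2 * (univ.filter (fun t => p t = s ∨ q t = s)).card +
      (univ.filter (fun t => p t ≠ s ∧ q t ≠ s)).card := by
  classical
  -- the decomposition in the official data format
  let Sset : Fin (Ns + Np) → Finset (Fin 5) := Fin.addCases (fun k => ({i k} : Finset (Fin 5))) (fun t => {p t, q t})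
  let U : Fin (Ns + Np) → (Fin 5 → Fin 5) → ℂ := Fin.addCases (fun k v => α k (v (i k))) (fun t => u t)
  let V : Fin (Ns + Np) → (Fin 5 → Fin 5) → ℂ := Fin.addCases W (fun t => w t)
  have hS1 : ∀ k, Sset (Fin.castAdd Np k) = {i k} := fun k => by simp [Sset]
  have hS2 : ∀ t, Sset (Fin.natAdd Ns t) = {p t, q t} := fun t => by simp [Sset]
  have hU1 : ∀ k, U (Fin.castAdd Np k) = fun v => α k (v (i k)) := fun k => by simp [U]
  have hU2 : ∀ t, U (Fin.natAdd Ns t) = u t := fun t => by simp [U]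
  have hV1 : ∀ k, V (Fin.castAdd Np k) = W k := fun k => by simp [V]
  have hV2 : ∀ t, V (Fin.natAdd Ns t) = w t := fun t => by simp [V]
  have hUloc : ∀ x, ∀ v v' : Fin 5 → Fin 5, (∀ j ∈ Sset x, v j = v' j) → U x v = U x v' := by
    intro x v v' hvv'
    induction x using Fin.addCases with
    | left k =>
      rw [hU1]
      have := hvv' (i k) (by rw [hS1]; simp)
      simp [this]
    | right t =>
      rw [hU2]
      exact hu t v v' (hvv' (p t) (by rw [hS2]; simp)) (hvv' (q t) (by rw [hS2]; simp))
  have hVloc : ∀ x, ∀ v v' : Fin 5 → Fin 5, (∀ j, j ∉ Sset x → v j = v' j) → V x v = V x v' := by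
    intro x v v' hvv'
    induction x using Fin.addCases with
    | left k =>
      rw [hV1]
      exact hW k v v' (fun j hj => hvv' j (by rw [hS1]; simpa using hj))
    | right t =>
      rw [hV2]
      exact hw t v v' (fun j hjp hjq => hvv' j (by rw [hS2]; simp [hjp, hjq]))
  have hsum : ∀ v : Fin 5 → Fin 5, (∑ x ∈ (univ : Finset (Fin (Ns + Np))), U x v * V x v) =
      if Function.Injective v then 1 else 0 := by
    intro v
    rw [Fin.sum_univ_add]
    simp only [hU1, hU2, hV1, hV2]
    exact (H v).symm
  -- the killed terms: the slices at `s`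
  let K : Finset (Fin (Ns + Np)) := (univ.filter (fun k => i k = s)).image (Fin.castAdd Np)
  have hKmem : ∀ x, x ∈ K ↔ ∃ k, i k = s ∧ Fin.castAdd Np k = x := fun x => by simp [K]
  have hK : ∀ x ∈ K, (s ∈ Sset x ∧ ∀ v : Fin 5 → Fin 5, ∑ c, lam c * U x (Function.update v s c) = 0) ∨
      (s ∉ Sset x ∧ ∀ v : Fin 5 → Fin 5, ∑ c, lam c * V x (Function.update v s c) = 0) := by
    intro x hx
    obtain ⟨k, hk, rfl⟩ := (hKmem x).mp hx
    left
    refine ⟨by rw [hS1, ← hk]; exact mem_singleton_self _, fun v => ?_⟩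
    rw [hU1]
    have := hkill k hk
    simpa [← hk] using this
  have hb := contract_rect (d := 4) (fun c => if c = 2 then 1 else if c = 1 ∨ c = 3 then 2 else 10) 10 h45
    univ Sset U V hUloc hVloc hsum s lam hlam K (subset_univ _) hK
  -- evaluate the weights of the surviving terms
  have hcS : ∀ k, (univ.filter (fun k' : Fin 4 => s.succAbove k' ∈ Sset (Fin.castAdd Np k))).card =
      if i k = s then 0 else 1 := by
    intro k
    have h := LaplaceRestrict.card_eq s (Sset (Fin.castAdd Np k))
    rw [hS1, card_singleton] at h
    rw [hS1]
    by_cases hik : i k = s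
    · rw [if_pos hik]; rw [if_pos (mem_singleton.mpr hik.symm)] at h; omega
    · rw [if_neg hik]; rw [if_neg (fun e => hik (mem_singleton.mp e).symm)] at h; omega
  have hcP : ∀ t, (univ.filter (fun k' : Fin 4 => s.succAbove k' ∈ Sset (Fin.natAdd Ns t))).card =
      if p t = s ∨ q t = s then 1 else 2 := by
    intro t
    have h := LaplaceRestrict.card_eq s (Sset (Fin.natAdd Ns t))
    rw [hS2, card_pair (hpq t)] at h
    rw [hS2]
    by_cases hst : p t = s ∨ q t = s
    · rw [if_pos hst]
      have hmem : s ∈ ({p t, q t} : Finset (Fin 5)) := by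
        rw [mem_insert, mem_singleton]; rcases hst with e | e
        · exact Or.inl e.symm
        · exact Or.inr e.symm
      rw [if_pos hmem] at h; omega
    · rw [if_neg hst]
      have hmem : s ∉ ({p t, q t} : Finset (Fin 5)) := by
        rw [mem_insert, mem_singleton]; push Not at hst ⊢; exact ⟨fun e => hst.1 e.symm, fun e => hst.2 e.symm⟩
      rw [if_neg hmem] at h; omega
  -- the sum over the surviving terms
  set f : Fin (Ns + Np) → ℕ := fun x =>
    (if (univ.filter (fun k' : Fin 4 => s.succAbove k' ∈ Sset x)).card = 2 then 1 else
      if (univ.filter (fun k' : Fin 4 => s.succAbove k' ∈ Sset x)).card = 1 ∨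
        (univ.filter (fun k' : Fin 4 => s.succAbove k' ∈ Sset x)).card = 3 then 2 else 10) with hf
  have hfS : ∀ k, i k ≠ s → f (Fin.castAdd Np k) = 2 := fun k hk => by
    simp only [hf]; rw [hcS k, if_neg hk]; decide
  have hfP : ∀ t, f (Fin.natAdd Ns t) = if p t = s ∨ q t = s then 2 else 1 := fun t => by
    simp only [hf]; rw [hcP t]
    by_cases hst : p t = s ∨ q t = s
    · rw [if_pos hst, if_pos hst]; decide
    · rw [if_neg hst, if_neg hst]; decide
  have hnotK : ∀ t, Fin.natAdd Ns t ∉ K := by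
    intro t ht
    obtain ⟨k, -, hk⟩ := (hKmem _).mp ht
    have := congrArg Fin.val hk
    simp at this
    omega
  have hKS : ∀ k, Fin.castAdd Np k ∈ K ↔ i k = s := by
    intro k
    rw [hKmem]
    constructor
    · rintro ⟨k', hk', e⟩
      rw [← Fin.castAdd_inj.mp e]; exact hk'
    · intro h; exact ⟨k, h, rfl⟩
  have hsplit : ∑ x ∈ univ \ K, f x =
      2 * (univ.filter (fun k => i k ≠ s)).card + (2 * (univ.filter (fun t => p t = s ∨ q t = s)).card +
        (univ.filter (fun t => p t ≠ s ∧ q t ≠ s)).card) := by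
    have h1 : ∑ x ∈ univ \ K, f x = ∑ x, (if x ∈ univ \ K then f x else 0) := by
      rw [sum_ite_mem, univ_inter]
    rw [h1, Fin.sum_univ_add]
    congr 1
    · have : ∀ k, (if Fin.castAdd Np k ∈ univ \ K then f (Fin.castAdd Np k) else 0) = if i k ≠ s then 2 else 0 := by
        intro k
        by_cases hk : i k = s
        · rw [if_neg (by simp [hKS, hk]), if_neg (by simp [hk])]
        · rw [if_pos (by simp [hKS, hk]), if_pos hk, hfS k hk]
      simp only [this]
      rw [← sum_filter, sum_const, smul_eq_mul, mul_comm]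
    · have : ∀ t, (if Fin.natAdd Ns t ∈ univ \ K then f (Fin.natAdd Ns t) else 0) =
          (if p t = s ∨ q t = s then 2 else 0) + (if p t ≠ s ∧ q t ≠ s then 1 else 0) := by
        intro t
        rw [if_pos (by simp [hnotK t]), hfP t]
        by_cases hst : p t = s ∨ q t = s
        · rw [if_pos hst, if_pos hst, if_neg (fun h => hst.elim h.1 h.2)]
        · rw [if_neg hst, if_neg hst, if_pos (not_or.mp hst)]
      simp only [this]
      rw [sum_add_distrib, ← sum_filter, ← sum_filter, sum_const, sum_const, smul_eq_mul, smul_eq_mul, mul_comm,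
        mul_one]
  rw [hsplit] at hb
  omega

/-- **A labelled configuration violating the rectangular count is impossible** (contrapositive packaging of
`contract_five_rect`, LO(4,5) as hypothesis). -/
theorem config_contract_rect
    (h45 : LaplaceOptimalFourFive)
    {Ns Np : ℕ}
    (i : Fin Ns → Fin 5) (α : Fin Ns → Fin 5 → ℂ) (W : Fin Ns → (Fin 5 → Fin 5) → ℂ)
    (hW : ∀ k, ∀ v v' : Fin 5 → Fin 5, (∀ j, j ≠ i k → v j = v' j) → W k v = W k v')
    (p q : Fin Np → Fin 5) (hpq : ∀ t, p t ≠ q t) (u w : Fin Np → (Fin 5 → Fin 5) → ℂ)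
    (hu : ∀ t, ∀ v v' : Fin 5 → Fin 5, v (p t) = v' (p t) → v (q t) = v' (q t) → u t v = u t v')
    (hw : ∀ t, ∀ v v' : Fin 5 → Fin 5, (∀ j, j ≠ p t → j ≠ q t → v j = v' j) → w t v = w t v')
    (s : Fin 5) (lam : Fin 5 → ℂ) (hlam : ∀ c, lam c ≠ 0) (hkill : ∀ k, i k = s → ∑ c, lam c * α k c = 0)
    (hlt : 2 * (univ.filter (fun k => i k ≠ s)).card + 2 * (univ.filter (fun t => p t = s ∨ q t = s)).card +
      (univ.filter (fun t => p t ≠ s ∧ q t ≠ s)).card < 10) :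
    ¬ ∀ v : Fin 5 → Fin 5,
      (if Function.Injective v then (1 : ℂ) else 0) = (∑ k, α k (v (i k)) * W k v) + ∑ t, u t v * w t v :=
  fun H => absurd (contract_five_rect h45 i α W hW p q hpq u w hu hw H s lam hlam hkill) (not_le.mpr hlt)

/-! ### §5 The pair half from LO(4,5): no idle slot -/

/-- **No idle slot, from LO(4,5).**  `LaplaceOptimalFourFive` implies the pair-half bound (slices weigh `2 ≤ 10`), hence by
`no_idle_slot_of_rect`: a slice-free split-rank-one decomposition of `P₅` of Laplace weight `< 120` uses every slot `q` on
the pair side of some term. -/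
theorem no_idle_slot_of_fourFive (h45 : LaplaceOptimalFourFive)
    {N : ℕ} (T : Finset (Fin N)) (S : Fin N → Finset (Fin 5)) (u w : Fin N → (Fin 5 → Fin 5) → ℂ)
    (hu : ∀ t, ∀ v v' : Fin 5 → Fin 5, (∀ j ∈ S t, v j = v' j) → u t v = u t v')
    (hw : ∀ t, ∀ v v' : Fin 5 → Fin 5, (∀ j, j ∉ S t → v j = v' j) → w t v = w t v')
    (hsum : ∀ v : Fin 5 → Fin 5, (∑ t ∈ T, u t v * w t v) = if Function.Injective v then 1 else 0)
    (hcheap : ∑ t ∈ T, (S t).card.factorial * (5 - (S t).card).factorial < Nat.factorial 5)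
    (hpairs : ∀ t ∈ T, (S t).card = 2 ∨ (S t).card = 3) (q : Fin 5) :
    ∃ t ∈ T, (q ∈ S t ∧ (S t).card = 2) ∨ (q ∉ S t ∧ (S t).card = 3) := by
  refine no_idle_slot_of_rect ?_ T S u w hu hw hsum hcheap hpairs q
  intro N' T' S' u' w' hu' hw' hsum'
  refine (h45 N' T' S' u' w' hu' hw' hsum').trans (sum_le_sum fun t _ => ?_)
  by_cases h2 : (S' t).card = 2
  · rw [if_pos h2, if_pos h2]
  · rw [if_neg h2, if_neg h2]
    split_ifs <;> omega

end LaplaceContractRect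

end Summit.ValiantsHypothesis.ValiantsHypothesis.Theorems.RigidityForcesSymmetryRankRigidMinimalRepr
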